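import Mathlib
import Summits.Ventures.PercRepro2.Defs
import Summits.Ventures.PercRepro2.Independence
import Summits.Ventures.PercRepro2.Harris
import Summits.Ventures.PercRepro2.Graph
import Summits.Ventures.PercRepro2.Exploration
import Summits.Ventures.PercRepro2.ObsIndependence

/-!
# (BASE′): the one-avoidance half of the two-colouring base is a theorem
(blind cell PercRepro2, p1; `proofs/P1-TWOCOPY.md` §9)

Uniform 2-colourings of the edges = the product measure with every weight `1/2`; red = the
configuration `ω`, blue = its complement `flipAll ω`. For vertices `l, h, o, b`:

  `P(l ↮_R h, o ↔_R l, b ↔_R h) ≤ P(l ↮_R h, o ↔_R l, b ↔_B h)`            (`basePrime`)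

— the 2-colouring statement (BASE) of `TwoCopyBHK.lean` WITHOUT the blue avoidance `l ↮_B h`.
Proof: explore the red cluster `W = C_l(ω)` (`expect_tower`). On `{C_l = W}` with `h ∉ W` the red
connection `b ↔_R h` only uses edges not touching `W` (`conn_restrict_iff_of_cluster_eq`), while the
blue connection `b ↔_B h` is at least the blue connection through the edges not touching `W`
(`conn_mono`); the two restricted connection probabilities coincide because the global flip
preserves the uniform measure (`prob_half_flipAll`). Hence the blue side dominates the red side
fibre by fibre. (BASE) itself — with the blue avoidance — is exactly the statement whose
per-fibre version fails; it stays a conjecture (`CrossCount`). Consequence (paper, §9): (BASE)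
holds whenever `l` or `h` is a leaf.
-/

namespace Summit.Ventures.PercRepro2

section FlipAll

variable {E : Type*} [Fintype E] [DecidableEq E]

/-- The complementary configuration (the blue edges of the 2-colouring `ω`). -/
def flipAll (ω : Config E) : Config E := fun e => !ω e

omit [Fintype E] [DecidableEq E] in
/-- `flipAll` is an involution. -/
lemma flipAll_involutive : Function.Involutive (flipAll (E := E)) := by
  intro ω
  funext e
  simp [flipAll]

/-- `flipAll` as a permutation of the configurations. -/
def flipAllEquiv : Equiv.Perm (Config E) := flipAll_involutive.toPerm

variable {R : Type*} [Field R] [LinearOrder R] [IsStrictOrderedRing R]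

/-- The uniform weight vector `1/2`. -/
def half : E → R := fun _ => 1 / 2

omit [DecidableEq E] in
/-- Every configuration has the same uniform weight. -/
lemma weight_half (ω : Config E) : weight (half (E := E) (R := R)) ω = (1 / 2 : R) ^ Fintype.card E := by
  unfold weight half
  have : ∀ e, edgeFactor (1 / 2 : R) (ω e) = 1 / 2 := by
    intro e
    cases ω e
    · simp [edgeFactor]; norm_num
    · simp [edgeFactor]
  simp only [this, Finset.prod_const, Finset.card_univ]

/-- The global flip preserves the uniform measure. -/
lemma prob_half_flipAll (A : Set (Config E)) :
    prob (half (E := E) (R := R)) (flipAll ⁻¹' A) = prob half A := by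
  unfold prob
  have h : ∀ ω, (flipAll ⁻¹' A).indicator (weight (half (R := R))) ω =
      A.indicator (weight half) (flipAll ω) := by
    intro ω
    by_cases hω : flipAll ω ∈ A
    · rw [Set.indicator_of_mem hω, Set.indicator_of_mem (show ω ∈ flipAll ⁻¹' A from hω),
        weight_half, weight_half]
    · rw [Set.indicator_of_notMem hω, Set.indicator_of_notMem (show ω ∉ flipAll ⁻¹' A from hω)]
  simp only [h]
  exact Equiv.sum_comp (flipAllEquiv (E := E)) (A.indicator (weight half))

end FlipAll

section BasePrime

variable {V : Type*} {E : Type*} [Fintype E] [DecidableEq E] [Fintype V] [DecidableEq V]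
  {R : Type*} [Field R] [LinearOrder R] [IsStrictOrderedRing R]

omit [Fintype E] [DecidableEq E] [Fintype V] [DecidableEq V] in
/-- Connections in a restricted configuration depend only on the restricted edges, also after
the flip. -/
lemma dependsOn_conn_restrict_flipAll (ends : E → Sym2 V) (F : Set E) [DecidablePred (· ∈ F)]
    (u w : V) :
    DependsOn (fun ω : Config E => Conn ends (restrict F (flipAll ω)) u w) F := by
  intro ω ω' h
  have : restrict F (flipAll ω) = restrict F (flipAll ω') := by
    funext e
    by_cases he : e ∈ F
    · rw [restrict_apply_of_mem he, restrict_apply_of_mem he]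
      simp [flipAll, h e he]
    · rw [restrict_apply_of_notMem he, restrict_apply_of_notMem he]
  simp only [this]

omit [Fintype E] [DecidableEq E] [Fintype V] [DecidableEq V] in
/-- A connection in a restriction of `ω` is a connection in `ω`. -/
lemma conn_of_conn_restrict {ends : E → Sym2 V} {F : Set E} [DecidablePred (· ∈ F)]
    {ω : Config E} {u w : V} (h : Conn ends (restrict F ω) u w) : Conn ends ω u w :=
  conn_mono (restrict_le F ω) h

omit [Fintype E] [DecidableEq E] in
/-- The uniform weights form a probability vector. -/
lemma isProbVec_half : IsProbVec (half (E := E) (R := R)) :=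
  ⟨fun _ => by simp only [half]; norm_num, fun _ => by simp only [half]; norm_num⟩

/-- **(BASE′)**: under uniform 2-colourings,
`P(l ↮_R h, o ↔_R l, b ↔_R h) ≤ P(l ↮_R h, o ↔_R l, b ↔_B h)`. -/
theorem basePrime (ends : E → Sym2 V) (l h o b : V) :
    prob (half (E := E) (R := R))
        ((connEvent ends l h)ᶜ ∩ connEvent ends l o ∩ connEvent ends h b) ≤
      prob (half (E := E) (R := R))
        ((connEvent ends l h)ᶜ ∩ connEvent ends l o ∩ flipAll ⁻¹' connEvent ends h b) := by
  classical
  -- the coefficient `c W = 1{o ∈ W} 1{h ∉ W}` and the two observables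
  let c : Set V → R := fun W => ({W' : Set V | o ∈ W' ∧ h ∉ W'}).indicator 1 W
  let DR : Set V → Config E → R := fun W =>
    ({ω | Conn ends (restrict (touches ends W)ᶜ ω) h b} : Set (Config E)).indicator 1
  let DB : Set V → Config E → R := fun W =>
    ({ω | Conn ends (restrict (touches ends W)ᶜ (flipAll ω)) h b} : Set (Config E)).indicator 1
  let ΦR : Set V → Config E → R := fun W ω => c W * DR W ω
  let ΦB : Set V → Config E → R := fun W ω => c W * DB W ω
  have hΦR : ∀ W, DependsOn (ΦR W) (touches ends W)ᶜ := by
    intro W ω ω' hωω'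
    simp only [ΦR, DR]
    congr 1
    exact dependsOn_indicator (R := R)
      (dependsOn_restrict (touches ends W)ᶜ fun ω' => Conn ends ω' h b) hωω'
  have hΦB : ∀ W, DependsOn (ΦB W) (touches ends W)ᶜ := by
    intro W ω ω' hωω'
    simp only [ΦB, DB]
    congr 1
    exact dependsOn_indicator (R := R) (dependsOn_conn_restrict_flipAll ends _ h b) hωω'
  have hS : ∀ W : Set V, DependsOn (· ∈ {ω | cluster ends ω l = W}) (touches ends W) :=
    fun W => dependsOn_clusterEvent ends l W
  have hdisj : ∀ W : Set V, Disjoint (touches ends W) (touches ends W)ᶜ :=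
    fun W => disjoint_compl_right
  -- pointwise: the red indicator IS `ΦR (C_l ω) ω`
  have hptR : ∀ ω, ((connEvent ends l h)ᶜ ∩ connEvent ends l o ∩ connEvent ends h b).indicator
      (1 : Config E → R) ω = ΦR (cluster ends ω l) ω := by
    intro ω
    simp only [ΦR, c, DR]
    by_cases hh : h ∈ cluster ends ω l
    · have h1 : ω ∉ (connEvent ends l h)ᶜ ∩ connEvent ends l o ∩ connEvent ends h b :=
        fun hm => hm.1.1 hh
      rw [Set.indicator_of_notMem h1,
        Set.indicator_of_notMem (show cluster ends ω l ∉ {W' : Set V | o ∈ W' ∧ h ∉ W'} from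
          fun hm => hm.2 hh)]
      simp
    · by_cases ho : o ∈ cluster ends ω l
      · rw [Set.indicator_of_mem (show cluster ends ω l ∈ {W' : Set V | o ∈ W' ∧ h ∉ W'} from
          ⟨ho, hh⟩)]
        have hconn : Conn ends (restrict (touches ends (cluster ends ω l))ᶜ ω) h b ↔
            Conn ends ω h b := conn_restrict_iff_of_cluster_eq rfl hh
        by_cases hb : Conn ends ω h b
        · rw [Set.indicator_of_mem (show ω ∈ (connEvent ends l h)ᶜ ∩ connEvent ends l o ∩
              connEvent ends h b from ⟨⟨hh, ho⟩, hb⟩),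
            Set.indicator_of_mem (show ω ∈ {ω' | Conn ends
              (restrict (touches ends (cluster ends ω l))ᶜ ω') h b} from hconn.2 hb)]
          simp
        · rw [Set.indicator_of_notMem (show ω ∉ (connEvent ends l h)ᶜ ∩ connEvent ends l o ∩
              connEvent ends h b from fun hm => hb hm.2),
            Set.indicator_of_notMem (show ω ∉ {ω' | Conn ends
              (restrict (touches ends (cluster ends ω l))ᶜ ω') h b} from fun hm => hb (hconn.1 hm))]
          simp
      · rw [Set.indicator_of_notMem (show ω ∉ (connEvent ends l h)ᶜ ∩ connEvent ends l o ∩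
            connEvent ends h b from fun hm => ho hm.1.2),
          Set.indicator_of_notMem (show cluster ends ω l ∉ {W' : Set V | o ∈ W' ∧ h ∉ W'} from
            fun hm => ho hm.1)]
        simp
  -- pointwise: the blue indicator dominates `ΦB (C_l ω) ω`
  have hptB : ∀ ω, ΦB (cluster ends ω l) ω ≤ ((connEvent ends l h)ᶜ ∩ connEvent ends l o ∩
      flipAll ⁻¹' connEvent ends h b).indicator (1 : Config E → R) ω := by
    intro ω
    simp only [ΦB, c, DB]
    by_cases hc : cluster ends ω l ∈ {W' : Set V | o ∈ W' ∧ h ∉ W'}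
    · rw [Set.indicator_of_mem hc, Pi.one_apply, one_mul]
      by_cases hd : ω ∈ {ω' | Conn ends (restrict (touches ends (cluster ends ω l))ᶜ (flipAll ω')) h b}
      · rw [Set.indicator_of_mem hd]
        have hmem : ω ∈ (connEvent ends l h)ᶜ ∩ connEvent ends l o ∩ flipAll ⁻¹' connEvent ends h b :=
          ⟨⟨hc.2, hc.1⟩, conn_of_conn_restrict hd⟩
        rw [Set.indicator_of_mem hmem]
      · rw [Set.indicator_of_notMem hd]
        exact Set.indicator_apply_nonneg fun _ => zero_le_one
    · rw [Set.indicator_of_notMem hc, zero_mul]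
      exact Set.indicator_apply_nonneg fun _ => zero_le_one
  -- the two fibre expectations agree (flip invariance at `1/2`)
  have hexp : ∀ W, expect (half (E := E) (R := R)) (ΦR W) = expect half (ΦB W) := by
    intro W
    simp only [ΦR, ΦB, DR, DB]
    rw [expect_const_mul, expect_const_mul, ← prob_eq_expect_indicator, ← prob_eq_expect_indicator]
    congr 1
    have : {ω : Config E | Conn ends (restrict (touches ends W)ᶜ (flipAll ω)) h b} =
        flipAll ⁻¹' {ω : Config E | Conn ends (restrict (touches ends W)ᶜ ω) h b} := by
      ext ω; simp
    rw [this, prob_half_flipAll]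
  -- assemble
  have hR : prob (half (E := E) (R := R))
      ((connEvent ends l h)ᶜ ∩ connEvent ends l o ∩ connEvent ends h b) =
      ∑ ω, weight (half (E := E) (R := R)) ω * expect half (ΦB (cluster ends ω l)) := by
    rw [prob_eq_expect_indicator]
    have e1 : ((connEvent ends l h)ᶜ ∩ connEvent ends l o ∩ connEvent ends h b).indicator
        (1 : Config E → R) = fun ω => ΦR (cluster ends ω l) ω := funext hptR
    rw [e1, expect_tower half hdisj (S := fun ω => cluster ends ω l) hS hΦR]
    simp only [hexp]
  have hB : ∑ ω, weight (half (E := E) (R := R)) ω * expect half (ΦB (cluster ends ω l)) ≤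
      prob (half (E := E) (R := R))
        ((connEvent ends l h)ᶜ ∩ connEvent ends l o ∩ flipAll ⁻¹' connEvent ends h b) := by
    rw [← expect_tower half hdisj (S := fun ω => cluster ends ω l) hS hΦB, prob_eq_expect_indicator]
    unfold expect
    refine Finset.sum_le_sum fun ω _ => ?_
    exact mul_le_mul_of_nonneg_left (hptB ω) (weight_nonneg isProbVec_half ω)
  rw [hR]
  exact hB

end BasePrime

end Summit.Ventures.PercRepro2
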